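/-
Origin: expansion seat `planner-pub-hodgecm-pv07-0`, handover 2026-08-18T03:38:59Z (`HOME/pub-hodgecm-pv07/lean/Pv07/KernelRadius.lean`, md5 014a3170, 180 lines);
landed by the gen-5 packager in gate run 19 as `HodgeCM/PerL34/LocalFactors/KernelRadius.lean` (import ^import Pv07\.(BallDichotomy|SplitFactor|CompactFactor|KernelRadius)\b→import HodgeCM.PerL34.LocalFactors.\1 ×1).
-/
/-
Copyright: HodgeCM publication cell (pub-hodgecm), DAG node N31f (prover pv07).
Released under the package licence.

# N31f addendum — "taking `N` so large that `U₁` lies in the kernel of `χ'_v`"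
# (PerL v5 Lemma 4.2(b), proof, tex ll. 619–621)

Source under adjudication (NOT cited as a fact; this file PROVES the step):
PerL v5 = `inputs/2001/summits__hodge-w-picard-modular-quadrilinear-period-galois-
closure__free__y1__paper__paper.tex`, ll. 619–621, verbatim:

  619: ... and, taking $N$ so
  620: large that $U_1:=\{y:\ yD=D\}=1+\varpi^{\,N-\mathrm{ord}(x_0)}\mathcal O_{L_{0,v}}$ (an
       open subgroup) lies in the kernel of $\chi'_v$ and
  621: of the auxiliary unitary character, ...

In `Pv07.SplitFactor` (`N31f_core_split`) this choice of `N` is carried as the two hypotheses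
`ha : ∀ y ∈ U₁, a y = 1`, `hχ : ∀ y ∈ U₁, χ y = 1`.  Here it is DISCHARGED: for unitary characters
`ν, χ` of `F^×` (multiplicative on non-zero elements, continuous at `1`) and any centre `x₀ ≠ 0`
there is a radius `r₀ > 0` such that for EVERY radius `0 < r ≤ r₀` (in particular `r = |ϖ|^N`
for all large `N`) both characters are trivial on `U₁ = U1 x₀ r`, whence
`I_v(𝟙_D) = vol(D)·vol(U₁) > 0` with NO residual hypothesis on the characters
(`exists_radius_integral_ballCoeff_pos`).

The proof is the tex's own mechanism for l. 620 (an open subgroup on which a continuous unitary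
character is trivial exists because THE CIRCLE HAS NO SMALL SUBGROUPS — the same principle as
ll. 623–626), imported from node N31g: `HodgeCM.PerL34.NoSmallSubgroups`
(`Circle.subgroup_eq_bot_of_forall_re_pos`, prover pv10, landed run 18).

Dictionary: `F` = `L_{0,v}` (any normed field with an ultrametric norm); a unitary character of
`F^×` is modelled as a function `F → Circle` multiplicative on `F ∖ {0}` (its value at `0` is never
used) and continuous at `1` for the topology of `F`; `U1 x₀ r`, `ballCoeff` as in
`Pv07.BallDichotomy` / `Pv07.SplitFactor`; the weight of l. 611 is `a(y) = ν(y)|y|^{3/2}`.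
-/
import Summits.HodgeConjecture.HodgeCM.PerL34.LocalFactors.SplitFactor
import Summits.HodgeConjecture.HodgeCM.PerL34.NoSmallSubgroups

/-! PORT of `HodgeCM/PerL34/LocalFactors/KernelRadius.lean` (HodgeCMPerL run 82) — verbatim mechanical port; provenance in the PORT header line. -/

namespace HodgeCM
namespace PerL34
namespace LocalFactors

open Metric Set MeasureTheory Filter Topology
open scoped Pointwise

variable {F : Type*} [NormedField F] [IsUltrametricDist F]
variable {ι : Type*} [Fintype ι]

omit [IsUltrametricDist F] in
/-- A function multiplicative on non-zero elements sends `1` to `1`. -/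
theorem map_one_of_mul {χ : F → Circle}
    (hmul : ∀ y z : F, y ≠ 0 → z ≠ 0 → χ (y * z) = χ y * χ z) : χ 1 = 1 := by
  have h := hmul 1 1 one_ne_zero one_ne_zero
  rw [mul_one] at h
  have h2 : χ 1 * χ 1 = χ 1 * 1 := by rw [mul_one]; exact h.symm
  exact mul_left_cancel h2

omit [IsUltrametricDist F] in
/-- A function multiplicative on non-zero elements is compatible with inversion there. -/
theorem map_inv_of_mul {χ : F → Circle}
    (hmul : ∀ y z : F, y ≠ 0 → z ≠ 0 → χ (y * z) = χ y * χ z) {y : F} (hy : y ≠ 0) :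
    χ y⁻¹ = (χ y)⁻¹ := by
  have h := hmul y y⁻¹ hy (inv_ne_zero hy)
  rw [mul_inv_cancel₀ hy, map_one_of_mul hmul] at h
  exact eq_inv_of_mul_eq_one_right h.symm

/-- The image `χ(U₁)` of the subgroup `U₁ ⊂ F^×` under a multiplicative `χ`, as a subgroup of the
circle (tex l. 625: "the image of that subgroup is a subgroup of the circle"). -/
def imageSubgroup (χ : F → Circle)
    (hmul : ∀ y z : F, y ≠ 0 → z ≠ 0 → χ (y * z) = χ y * χ z) {x₀ : ι → F} {r : ℝ}
    (hr : r < ‖x₀‖) (hr0 : 0 ≤ r) : Subgroup Circle where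
  carrier := χ '' U1 x₀ r
  mul_mem' := by
    rintro _ _ ⟨y, hy, rfl⟩ ⟨z, hz, rfl⟩
    exact ⟨y * z, mul_mem_U1 hr hy hz,
      hmul y z (ne_zero_of_mem_U1 hr hy) (ne_zero_of_mem_U1 hr hz)⟩
  one_mem' := ⟨1, one_mem_U1 hr0, map_one_of_mul hmul⟩
  inv_mem' := by
    rintro _ ⟨y, hy, rfl⟩
    exact ⟨y⁻¹, inv_mem_U1 hr hy, map_inv_of_mul hmul (ne_zero_of_mem_U1 hr hy)⟩

/-- (Ported verbatim from the HodgeCMPerL package; no docstring in the source.) -/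
theorem mem_imageSubgroup {χ : F → Circle}
    {hmul : ∀ y z : F, y ≠ 0 → z ≠ 0 → χ (y * z) = χ y * χ z} {x₀ : ι → F} {r : ℝ}
    {hr : r < ‖x₀‖} {hr0 : 0 ≤ r} {z : Circle} :
    z ∈ imageSubgroup χ hmul hr hr0 ↔ ∃ y ∈ U1 x₀ r, χ y = z := Iff.rfl

/-- **tex ll. 619–621, PROVED**: a unitary character `χ` of `F^×` (multiplicative on `F ∖ {0}`,
continuous at `1`) is trivial on `U₁ = U1 x₀ r` for ALL sufficiently small radii `r > 0`
("taking `N` so large that `U₁ … lies in the kernel of `χ'_v`").  Mechanism: by continuity `U₁` is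
mapped into the arc `{re > 0}` for `r` small; its image is a subgroup of the circle inside that arc,
hence trivial (`NoSmallSubgroups.Circle.subgroup_eq_bot_of_forall_re_pos`, node N31g). -/
theorem exists_radius_forall_U1_eq_one (χ : F → Circle)
    (hmul : ∀ y z : F, y ≠ 0 → z ≠ 0 → χ (y * z) = χ y * χ z) (hcont : ContinuousAt χ 1)
    {x₀ : ι → F} (hx : x₀ ≠ 0) :
    ∃ r₀ : ℝ, 0 < r₀ ∧ r₀ < ‖x₀‖ ∧
      ∀ r : ℝ, 0 < r → r ≤ r₀ → ∀ y ∈ U1 x₀ r, χ y = 1 := by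
  have hone : χ 1 = 1 := map_one_of_mul hmul
  have hpre : χ ⁻¹' {z : Circle | 0 < (z : ℂ).re} ∈ 𝓝 (1 : F) := by
    apply hcont.preimage_mem_nhds
    rw [hone]
    exact NoSmallSubgroups.Circle.setOf_re_pos_mem_nhds_one
  obtain ⟨ε, hε, hball⟩ := Metric.mem_nhds_iff.mp hpre
  have hx' : 0 < ‖x₀‖ := norm_pos_iff.mpr hx
  have hlt : min (ε / 2) (1 / 2) * ‖x₀‖ < ‖x₀‖ := by
    calc min (ε / 2) (1 / 2) * ‖x₀‖ ≤ (1 / 2) * ‖x₀‖ := by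
          gcongr
          exact min_le_right _ _
      _ < ‖x₀‖ := by linarith
  refine ⟨min (ε / 2) (1 / 2) * ‖x₀‖, by positivity, hlt, ?_⟩
  intro r hr0 hrle y hy
  have hr : r < ‖x₀‖ := lt_of_le_of_lt hrle hlt
  have hH : ∀ z ∈ imageSubgroup χ hmul hr hr0.le, 0 < (z : ℂ).re := by
    rintro _ ⟨w, hw, rfl⟩
    apply hball
    rw [U1_eq_closedBall hx, mem_closedBall] at hw
    rw [mem_ball]
    calc dist w 1 ≤ r / ‖x₀‖ := hw
      _ ≤ min (ε / 2) (1 / 2) := by rwa [div_le_iff₀ hx']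
      _ ≤ ε / 2 := min_le_left _ _
      _ < ε := by linarith
  have hbot := NoSmallSubgroups.Circle.subgroup_eq_bot_of_forall_re_pos _ hH
  exact (Subgroup.eq_bot_iff_forall _).mp hbot (χ y) ⟨y, hy, rfl⟩

/-- Two (or finitely many) characters at once: a common radius. -/
theorem exists_radius_forall_U1_eq_one₂ (ν χ : F → Circle)
    (hνm : ∀ y z : F, y ≠ 0 → z ≠ 0 → ν (y * z) = ν y * ν z) (hνc : ContinuousAt ν 1)
    (hχm : ∀ y z : F, y ≠ 0 → z ≠ 0 → χ (y * z) = χ y * χ z) (hχc : ContinuousAt χ 1)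
    {x₀ : ι → F} (hx : x₀ ≠ 0) :
    ∃ r₀ : ℝ, 0 < r₀ ∧ r₀ < ‖x₀‖ ∧
      ∀ r : ℝ, 0 < r → r ≤ r₀ → ∀ y ∈ U1 x₀ r, ν y = 1 ∧ χ y = 1 := by
  obtain ⟨r₁, h₁0, h₁lt, h₁⟩ := exists_radius_forall_U1_eq_one ν hνm hνc hx
  obtain ⟨r₂, h₂0, _, h₂⟩ := exists_radius_forall_U1_eq_one χ hχm hχc hx
  refine ⟨min r₁ r₂, lt_min h₁0 h₂0, lt_of_le_of_lt (min_le_left _ _) h₁lt, ?_⟩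
  intro r hr0 hrle y hy
  exact ⟨h₁ r hr0 (hrle.trans (min_le_left _ _)) y hy,
    h₂ r hr0 (hrle.trans (min_le_right _ _)) y hy⟩

/-- The weight of tex l. 611: `a(y) = ν(y)·|y|^{3/2}` (`ν` the auxiliary unitary character of the
splitting, `|y|^{3/2}` the dilation factor of the Schrödinger model on `𝒮(L_{0,v}^3)`). -/
noncomputable def dilationWeight (ν : F → Circle) (y : F) : ℂ :=
  (ν y : ℂ) * ((‖y‖ ^ (3 / 2 : ℝ) : ℝ) : ℂ)

/-- On `U₁ ⊂ 𝒪^×` (where `|y| = 1`) the weight reduces to `ν(y)`, hence to `1` where `ν` is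
trivial. -/
theorem dilationWeight_eq_one {ν : F → Circle} {x₀ : ι → F} {r : ℝ} (hr : r < ‖x₀‖) {y : F}
    (hy : y ∈ U1 x₀ r) (hν : ν y = 1) : dilationWeight ν y = 1 := by
  rw [dilationWeight, norm_eq_one_of_mem_U1 hr hy, Real.one_rpow, hν, Circle.coe_one,
    Complex.ofReal_one, mul_one]

variable [MeasurableSpace (ι → F)]

/-- **N31f, split place, with the choice of `N` DISCHARGED** (tex ll. 617–623, now including
ll. 619–621): for unitary characters `ν` (auxiliary, l. 611/621) and `χ = χ'_v` of `F^×`, continuous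
at `1`, and any centre `x₀ ≠ 0`, there is `r₀ > 0` such that for every radius `0 < r ≤ r₀`
(`r = |ϖ|^N`, `N` large) one has `r < ‖x₀‖` (`N > ord x₀`) and
`I_v(𝟙_D) = ∫ ν(y)|y|^{3/2}·vol(D ∩ y⁻¹D)·χ(y) dη(y) = c` for a real `c > 0`
(namely `vol(D)·vol(U₁)`, `integral_ballCoeff_mul_eq`). -/
theorem exists_radius_integral_ballCoeff_pos [MeasurableSpace F] [BorelSpace F]
    {μ : Measure (ι → F)} [μ.IsOpenPosMeasure] [IsFiniteMeasureOnCompacts μ]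
    [ProperSpace (ι → F)] (η : Measure F) [η.IsOpenPosMeasure] [IsFiniteMeasureOnCompacts η]
    [ProperSpace F] (ν χ : F → Circle)
    (hνm : ∀ y z : F, y ≠ 0 → z ≠ 0 → ν (y * z) = ν y * ν z) (hνc : ContinuousAt ν 1)
    (hχm : ∀ y z : F, y ≠ 0 → z ≠ 0 → χ (y * z) = χ y * χ z) (hχc : ContinuousAt χ 1)
    {x₀ : ι → F} (hx : x₀ ≠ 0) :
    ∃ r₀ : ℝ, 0 < r₀ ∧ ∀ r : ℝ, 0 < r → r ≤ r₀ →
      r < ‖x₀‖ ∧ ∃ c : ℝ, 0 < c ∧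
        ∫ y, ballCoeff (dilationWeight ν) μ x₀ r y * (χ y : ℂ) ∂η = (c : ℂ) := by
  obtain ⟨r₀, h0, hlt, hboth⟩ := exists_radius_forall_U1_eq_one₂ ν χ hνm hνc hχm hχc hx
  refine ⟨r₀, h0, fun r hr0 hrle => ?_⟩
  have hr : r < ‖x₀‖ := lt_of_le_of_lt hrle hlt
  refine ⟨hr, ?_⟩
  have ha : ∀ y ∈ U1 x₀ r, dilationWeight ν y = 1 := fun y hy =>
    dilationWeight_eq_one hr hy (hboth r hr0 hrle y hy).1
  have hχ : ∀ y ∈ U1 x₀ r, (fun y => (χ y : ℂ)) y = 1 := fun y hy => by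
    show (χ y : ℂ) = 1
    rw [(hboth r hr0 hrle y hy).2, Circle.coe_one]
  exact exists_integral_ballCoeff_pos η hr hr0 ha hχ

end LocalFactors
end PerL34
end HodgeCM
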